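import Mathlib.Analysis.Calculus.MeanValue
import Mathlib.Analysis.Calculus.Deriv.Pow
import Mathlib.MeasureTheory.Integral.IntervalIntegral.FundThmCalculus
import Mathlib.Topology.UniformSpace.HeineCantor
import HarnessLib

/-!
# Pathwise lemmas for the Taylor-expansion proof of Itô's formula

Deterministic estimates along one continuous path `x : ℝ≥0 → ℝ` and one finite grid
`u₀ ≤ u₁ ≤ ⋯ ≤ u_N` of `[0, t]`, used in the proof of Itô's formula for Itô processes
(`Literature.Analysis.FunctionSpaces.ito_formula_itoProcess_ae`) in the form of Le Gall (2016), Thm 5.10: writing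
`f(t, x_t) - f(0, x_0) = ∑ᵢ [f(uᵢ₊₁, xᵢ₊₁) - f(uᵢ, xᵢ₊₁)] + ∑ᵢ [f(uᵢ, xᵢ₊₁) - f(uᵢ, xᵢ)]`
(`xᵢ = x(uᵢ)`),

* `abs_taylor_two_sub_le` — the one-variable second-order Taylor estimate with a modulus of
  continuity of the second derivative (two applications of the mean value inequality), and its
  summed form `exists_forall_abs_sum_taylor_le` :
  `|∑ᵢ [f(uᵢ, xᵢ₊₁) - f(uᵢ, xᵢ) - ∂ₓf(uᵢ, xᵢ) Δᵢx - ½ ∂ₓₓf(uᵢ, xᵢ) (Δᵢx)²]| ≤ ε ∑ᵢ (Δᵢx)²`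
  for all grids of mesh `≤ δ(ε)`;
* `exists_forall_abs_sum_timeIncr_sub_integral_le` — the time increments:
  `|∑ᵢ [f(uᵢ₊₁, xᵢ₊₁) - f(uᵢ, xᵢ₊₁)] - ∫_{u₀}^{u_N} ∂ₜf(s, x_s) ds| ≤ ε (u_N - u₀)`;
* `exists_forall_abs_sum_mul_incr_primitive_sub_le` — Riemann–Stieltjes sums against an absolutely
  continuous path `V = ∫₀ b ds`: `|∑ᵢ φ(uᵢ) ΔᵢV - ∫ φ b ds| ≤ ε ∫ |b| ds`;
* `exists_forall_abs_quadSum_sub_quadSum_le` — for `x = x₀ + V + J`, the weighted quadratic sums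
  of `x` and of `J` differ by `≤ ε` on fine grids, and `∑ᵢ (ΔᵢV)² ≤ ε`;
* `abs_quadSum_sub_twoScale_le`, `abs_sum_mul_integral_sub_integral_le` — the two-scale
  comparison of a continuously weighted quadratic sum with the coarse-cell sums weighted at the
  coarse grid points `t j / 2ⁿ`, and of `∑ⱼ h(rⱼ) ∫_{rⱼ}^{rⱼ₊₁} q` with `∫ h q`
  (Le Gall's weak-convergence step, display (5.16), made quantitative);
* `sum_indicator_Ico_uniformGrid` — the partition of unity `∑ⱼ 𝟙_{[rⱼ, rⱼ₊₁)} = 𝟙_{[0, t)}`.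

Grids are `u : ℕ → ℝ≥0` with `N` cells, read through hypotheses (monotone on `range N`, all
points `≤ t`, cells `≤ δ`); no probability is involved.

## References

* J.-F. Le Gall, *Brownian Motion, Martingales, and Stochastic Calculus* (2016), Thm 5.10
  (proof), Prop. 4.21, Prop. 5.9.
* D. Revuz, M. Yor, *Continuous Martingales and Brownian Motion* (3rd ed., 1999), Ch. IV,
  Thm (3.3) and Remark 1°.
-/

open MeasureTheory Filter Finset intervalIntegral
open scoped NNReal Topology

noncomputable section

namespace Literature.Probability.Process

/-! ### Second-order Taylor estimate with a modulus of continuity -/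

/-- **Second-order Taylor estimate with a modulus of continuity of `φ''`**: if
`|φ''(z) - φ''(x)| ≤ w` on the segment `[x, y]`, then
`|φ(y) - φ(x) - φ'(x)(y - x) - ½ φ''(x)(y - x)²| ≤ w (y - x)²`
(mean value inequality applied to `z ↦ φ(z) - φ'(x) z - ½ φ''(x) (z - x)²`, whose derivative
`φ'(z) - φ'(x) - φ''(x)(z - x)` is itself bounded by `w |y - x|` by a second application).
Le Gall (2016), proof of Thm 5.10 (Taylor–Lagrange at order 2). [folklore] -/
theorem abs_taylor_two_sub_le {φ φ' φ'' : ℝ → ℝ} (hφ : ∀ z, HasDerivAt φ (φ' z) z)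
    (hφ' : ∀ z, HasDerivAt φ' (φ'' z) z) {x y w : ℝ}
    (hw : ∀ z ∈ Set.uIcc x y, |φ'' z - φ'' x| ≤ w) :
    |φ y - φ x - φ' x * (y - x) - 2⁻¹ * φ'' x * (y - x) ^ 2| ≤ w * (y - x) ^ 2 := by
  -- first application: the derivative of the remainder is small
  have hd1 : ∀ v, HasDerivAt (fun v ↦ φ' v - φ'' x * v) (φ'' v - φ'' x) v := fun v ↦ by
    have h := (hφ' v).sub ((hasDerivAt_id' v).const_mul (φ'' x))
    simp only [mul_one] at h
    exact h
  have inner : ∀ z ∈ Set.uIcc x y, |φ' z - φ' x - φ'' x * (z - x)| ≤ w * |y - x| := by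
    intro z hz
    have hsub : Set.uIcc x z ⊆ Set.uIcc x y := Set.uIcc_subset_uIcc_left hz
    have key := Convex.norm_image_sub_le_of_norm_deriv_le (𝕜 := ℝ)
      (f := fun v ↦ φ' v - φ'' x * v) (s := Set.uIcc x z) (C := w) (x := x) (y := z)
      (fun v _ ↦ (hd1 v).differentiableAt)
      (fun v hv ↦ by
        rw [(hd1 v).deriv]
        simpa using hw v (hsub hv))
      (convex_uIcc x z) Set.left_mem_uIcc Set.right_mem_uIcc
    rw [Real.norm_eq_abs, Real.norm_eq_abs] at key
    have heq : φ' z - φ'' x * z - (φ' x - φ'' x * x) = φ' z - φ' x - φ'' x * (z - x) := by ring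
    rw [heq] at key
    refine key.trans (mul_le_mul_of_nonneg_left ?_ ((abs_nonneg _).trans (hw x Set.left_mem_uIcc)))
    exact Set.abs_sub_left_of_mem_uIcc hz
  -- second application
  have hderiv : ∀ v, HasDerivAt (fun v ↦ φ v - φ' x * v - 2⁻¹ * φ'' x * (v - x) ^ 2)
      (φ' v - φ' x - φ'' x * (v - x)) v := by
    intro v
    have h1 := ((hφ v).sub ((hasDerivAt_id' v).const_mul (φ' x))).sub
      ((((hasDerivAt_id' v).sub_const x).pow 2).const_mul (2⁻¹ * φ'' x))
    have h2 : HasDerivAt (fun v ↦ φ v - φ' x * v - 2⁻¹ * φ'' x * (v - x) ^ 2)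
        (φ' v - φ' x * 1 - 2⁻¹ * φ'' x * ((2 : ℕ) * (v - x) ^ (2 - 1) * 1)) v := h1
    refine h2.congr_deriv ?_
    norm_num
    ring
  have key := Convex.norm_image_sub_le_of_norm_deriv_le (𝕜 := ℝ)
    (f := fun v ↦ φ v - φ' x * v - 2⁻¹ * φ'' x * (v - x) ^ 2) (s := Set.uIcc x y)
    (C := w * |y - x|) (x := x) (y := y) (fun v _ ↦ (hderiv v).differentiableAt)
    (fun v hv ↦ by rw [(hderiv v).deriv, Real.norm_eq_abs]; exact inner v hv)
    (convex_uIcc x y) Set.left_mem_uIcc Set.right_mem_uIcc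
  rw [Real.norm_eq_abs, Real.norm_eq_abs] at key
  have heq : φ y - φ' x * y - 2⁻¹ * φ'' x * (y - x) ^ 2 - (φ x - φ' x * x - 2⁻¹ * φ'' x * (x - x) ^ 2)
      = φ y - φ x - φ' x * (y - x) - 2⁻¹ * φ'' x * (y - x) ^ 2 := by ring
  rw [heq] at key
  calc _ ≤ w * |y - x| * |y - x| := key
    _ = w * (y - x) ^ 2 := by rw [mul_assoc, ← sq, sq_abs]

/-! ### Uniform continuity on compact time intervals, in `ε`–`δ` form -/

/-- A continuous path on `ℝ≥0` is bounded on `[0, t]`. [folklore] -/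
theorem exists_forall_abs_le_of_continuous {x : ℝ≥0 → ℝ} (hx : Continuous x) (t : ℝ≥0) :
    ∃ M : ℝ, ∀ s ≤ t, |x s| ≤ M := by
  obtain ⟨M, hM⟩ := (isCompact_Icc (a := (0 : ℝ≥0)) (b := t)).exists_bound_of_continuousOn
    hx.continuousOn
  exact ⟨M, fun s hs ↦ by simpa [Real.norm_eq_abs] using hM s ⟨zero_le, hs⟩⟩

/-- A continuous path on `ℝ≥0` is uniformly continuous on `[0, t]` (`ε`–`δ` form).
[folklore] -/
theorem exists_forall_abs_sub_le_of_continuous {x : ℝ≥0 → ℝ} (hx : Continuous x) (t : ℝ≥0)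
    {ε : ℝ} (hε : 0 < ε) :
    ∃ δ > 0, ∀ s ≤ t, ∀ s' ≤ t, |(s : ℝ) - s'| ≤ δ → |x s - x s'| ≤ ε := by
  have huc := (isCompact_Icc (a := (0 : ℝ≥0)) (b := t)).uniformContinuousOn_of_continuous
    hx.continuousOn
  obtain ⟨δ, hδ, h⟩ := Metric.uniformContinuousOn_iff_le.1 huc ε hε
  refine ⟨δ, hδ, fun s hs s' hs' hss' ↦ ?_⟩
  have := h s ⟨zero_le, hs⟩ s' ⟨zero_le, hs'⟩ (by rwa [NNReal.dist_eq])
  rwa [Real.dist_eq] at this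

/-- A continuous function of two real variables is uniformly continuous on the compact rectangle
`[0, T] × [-M, M]` (`ε`–`δ` form, sup distance). [folklore] -/
theorem exists_forall_abs_sub_le_of_continuous_uncurry {F : ℝ → ℝ → ℝ}
    (hF : Continuous (Function.uncurry F)) (T M : ℝ) {ε : ℝ} (hε : 0 < ε) :
    ∃ δ > 0, ∀ s ∈ Set.Icc 0 T, ∀ y ∈ Set.Icc (-M) M, ∀ s' ∈ Set.Icc 0 T,
      ∀ y' ∈ Set.Icc (-M) M, |s - s'| ≤ δ → |y - y'| ≤ δ → |F s y - F s' y'| ≤ ε := by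
  have hK : IsCompact (Set.Icc (0 : ℝ) T ×ˢ Set.Icc (-M) M) := isCompact_Icc.prod isCompact_Icc
  obtain ⟨δ, hδ, h⟩ := Metric.uniformContinuousOn_iff_le.1
    (hK.uniformContinuousOn_of_continuous hF.continuousOn) ε hε
  refine ⟨δ, hδ, fun s hs y hy s' hs' y' hy' h1 h2 ↦ ?_⟩
  have := h (s, y) ⟨hs, hy⟩ (s', y') ⟨hs', hy'⟩ (by
    rw [Prod.dist_eq, Real.dist_eq, Real.dist_eq]
    exact max_le h1 h2)
  rwa [Function.uncurry_apply_pair, Function.uncurry_apply_pair, Real.dist_eq] at this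

/-! ### The space increments: summed second-order Taylor estimate -/

/-- **Summed Taylor estimate along a grid.** Let `f(s, ·)` have first and second derivatives
`g(s, ·)`, `h(s, ·)` with `h` jointly continuous, and let `x` be a continuous path. For every
`ε > 0` there is `δ > 0` such that for every grid `u₀ ≤ ⋯ ≤ u_N` in `[0, t]` with cells `≤ δ`,
`|∑ᵢ [f(uᵢ, xᵢ₊₁) - f(uᵢ, xᵢ) - g(uᵢ, xᵢ) Δᵢx - ½ h(uᵢ, xᵢ) (Δᵢx)²]| ≤ ε ∑ᵢ (Δᵢx)²`
(`xᵢ = x(uᵢ)`, `Δᵢx = xᵢ₊₁ - xᵢ`): uniform continuity of `h` on `[0, t] × x([0, t])` and of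
`x` on `[0, t]`, and `abs_taylor_two_sub_le` cell by cell.
Le Gall (2016), proof of Thm 5.10 (the bound on `sup |f_{n,i} - F''(X_{tᵢ})|`). [folklore] -/
theorem exists_forall_abs_sum_taylor_le {f g h : ℝ → ℝ → ℝ}
    (hg : ∀ s y, HasDerivAt (f s) (g s y) y) (hh : ∀ s y, HasDerivAt (g s) (h s y) y)
    (hcont : Continuous (Function.uncurry h)) {x : ℝ≥0 → ℝ} (hx : Continuous x) (t : ℝ≥0)
    {ε : ℝ} (hε : 0 < ε) :
    ∃ δ > 0, ∀ (N : ℕ) (u : ℕ → ℝ≥0), (∀ i ≤ N, u i ≤ t) →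
      (∀ i < N, u i ≤ u (i + 1) ∧ (u (i + 1) : ℝ) - u i ≤ δ) →
      |∑ i ∈ range N, (f (u i) (x (u (i + 1))) - f (u i) (x (u i)) -
          g (u i) (x (u i)) * (x (u (i + 1)) - x (u i)) -
          2⁻¹ * h (u i) (x (u i)) * (x (u (i + 1)) - x (u i)) ^ 2)| ≤
        ε * ∑ i ∈ range N, (x (u (i + 1)) - x (u i)) ^ 2 := by
  obtain ⟨M, hM⟩ := exists_forall_abs_le_of_continuous hx t
  obtain ⟨δ₁, hδ₁, hF⟩ := exists_forall_abs_sub_le_of_continuous_uncurry hcont t M hε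
  obtain ⟨δ, hδ, hxδ⟩ := exists_forall_abs_sub_le_of_continuous hx t hδ₁
  refine ⟨δ, hδ, fun N u hut hu ↦ ?_⟩
  rw [mul_sum]
  refine (abs_sum_le_sum_abs _ _).trans (sum_le_sum fun i hi ↦ ?_)
  have hiN : i < N := mem_range.1 hi
  obtain ⟨hmono, hcell⟩ := hu i hiN
  have hui : u i ≤ t := hut i hiN.le
  have hui1 : u (i + 1) ≤ t := hut (i + 1) hiN
  refine abs_taylor_two_sub_le (hg (u i)) (hh (u i)) fun z hz ↦ ?_
  -- `z` lies between `x(uᵢ)` and `x(uᵢ₊₁)`, both in `[-M, M]` and within `δ₁` of each other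
  have hxi : x (u i) ∈ Set.Icc (-M) M := abs_le.1 (hM _ hui)
  have hxi1 : x (u (i + 1)) ∈ Set.Icc (-M) M := abs_le.1 (hM _ hui1)
  have hzM : z ∈ Set.Icc (-M) M := (Set.uIcc_subset_Icc hxi hxi1) hz
  have hzx : |z - x (u i)| ≤ δ₁ := by
    refine (Set.abs_sub_left_of_mem_uIcc hz).trans ?_
    rw [abs_sub_comm]
    refine hxδ _ hui _ hui1 ?_
    rw [abs_sub_comm, abs_of_nonneg (sub_nonneg.2 (NNReal.coe_le_coe.2 hmono))]
    exact hcell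
  have hsT : ((u i : ℝ≥0) : ℝ) ∈ Set.Icc (0 : ℝ) t := ⟨NNReal.coe_nonneg _, NNReal.coe_le_coe.2 hui⟩
  exact hF _ hsT z hzM _ hsT _ hxi (by simp [hδ₁.le]) hzx

/-! ### The time increments -/

/-- **The time increments are a Riemann sum of `∫ ∂ₜf(s, x_s) ds`.** Let `k(·, y)` be the
derivative of `s ↦ f(s, y)`, jointly continuous, and `x` a continuous path. For every `ε > 0`
there is `δ > 0` such that for every grid `u₀ ≤ ⋯ ≤ u_N` in `[0, t]` with cells `≤ δ`,
`|∑ᵢ [f(uᵢ₊₁, xᵢ₊₁) - f(uᵢ, xᵢ₊₁)] - ∫_{u₀}^{u_N} k(s, x_s) ds| ≤ ε (u_N - u₀)`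
(on each cell `f(uᵢ₊₁, y) - f(uᵢ, y) = ∫_{uᵢ}^{uᵢ₊₁} k(s, y) ds`, and `k(s, xᵢ₊₁)` is within `ε` of
`k(s, x_s)` there). Time is real; the path is read at `s⁺ = Real.toNNReal s`.
Le Gall (2016), Thm 5.10; Revuz–Yor (1999), Ch. IV, Thm (3.3), Remark 1° (the `dA`-term for
`A_t = t`). [folklore] -/
theorem exists_forall_abs_sum_timeIncr_sub_integral_le {f k : ℝ → ℝ → ℝ}
    (hk : ∀ s y, HasDerivAt (fun r ↦ f r y) (k s y) s) (hkc : Continuous (Function.uncurry k))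
    {x : ℝ≥0 → ℝ} (hx : Continuous x) (t : ℝ≥0) {ε : ℝ} (hε : 0 < ε) :
    ∃ δ > 0, ∀ (N : ℕ) (u : ℕ → ℝ≥0), (∀ i ≤ N, u i ≤ t) →
      (∀ i < N, u i ≤ u (i + 1) ∧ (u (i + 1) : ℝ) - u i ≤ δ) →
      |∑ i ∈ range N, (f (u (i + 1)) (x (u (i + 1))) - f (u i) (x (u (i + 1)))) -
          ∫ s in ((u 0 : ℝ≥0) : ℝ)..(u N : ℝ≥0), k s (x s.toNNReal)| ≤
        ε * ((u N : ℝ) - u 0) := by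
  obtain ⟨M, hM⟩ := exists_forall_abs_le_of_continuous hx t
  obtain ⟨δ₁, hδ₁, hF⟩ := exists_forall_abs_sub_le_of_continuous_uncurry hkc t M hε
  obtain ⟨δ, hδ, hxδ⟩ := exists_forall_abs_sub_le_of_continuous hx t hδ₁
  refine ⟨δ, hδ, fun N u hut hu ↦ ?_⟩
  -- continuity of the integrands
  have hky : ∀ y, Continuous fun s ↦ k s y := fun y ↦
    hkc.comp (continuous_id.prodMk continuous_const)
  have hkx : Continuous fun s : ℝ ↦ k s (x s.toNNReal) :=
    hkc.comp (continuous_id.prodMk (hx.comp continuous_real_toNNReal))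
  -- split the integral over the cells
  have hsplit := sum_integral_adjacent_intervals (μ := volume) (f := fun s ↦ k s (x s.toNNReal))
    (a := fun i ↦ ((u i : ℝ≥0) : ℝ)) (n := N) (fun i _ ↦ hkx.intervalIntegrable _ _)
  rw [← hsplit]
  -- the time increment of `f` over a cell is the integral of `k`
  have hcell : ∀ i, f (u (i + 1)) (x (u (i + 1))) - f (u i) (x (u (i + 1))) =
      ∫ s in ((u i : ℝ≥0) : ℝ)..(u (i + 1) : ℝ≥0), k s (x (u (i + 1))) := fun i ↦
    (integral_eq_sub_of_hasDerivAt (fun s _ ↦ hk s (x (u (i + 1))))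
      ((hky _).intervalIntegrable _ _)).symm
  simp_rw [hcell]
  rw [← sum_sub_distrib]
  have hsum : ε * ((u N : ℝ) - u 0) = ∑ i ∈ range N, ε * ((u (i + 1) : ℝ) - u i) := by
    rw [← mul_sum, sum_range_sub (fun i ↦ ((u i : ℝ≥0) : ℝ))]
  rw [hsum]
  refine (abs_sum_le_sum_abs _ _).trans (sum_le_sum fun i hi ↦ ?_)
  have hiN : i < N := mem_range.1 hi
  obtain ⟨hmono, hcellδ⟩ := hu i hiN
  have hui : u i ≤ t := hut i hiN.le
  have hui1 : u (i + 1) ≤ t := hut (i + 1) hiN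
  have hmono' : ((u i : ℝ≥0) : ℝ) ≤ u (i + 1) := NNReal.coe_le_coe.2 hmono
  rw [← integral_sub ((hky _).intervalIntegrable _ _) (hkx.intervalIntegrable _ _)]
  have hbound := norm_integral_le_of_norm_le_const (a := ((u i : ℝ≥0) : ℝ)) (b := (u (i + 1) : ℝ≥0))
    (f := fun s ↦ k s (x (u (i + 1))) - k s (x s.toNNReal)) (C := ε) fun s hs ↦ ?_
  · rw [Real.norm_eq_abs, abs_of_nonneg (sub_nonneg.2 hmono')] at hbound
    exact hbound
  -- the pointwise bound on the cell `s ∈ (uᵢ, uᵢ₊₁]`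
  rw [Set.uIoc_of_le hmono'] at hs
  have hs0 : 0 ≤ s := (NNReal.coe_nonneg _).trans hs.1.le
  have hsnn : (s.toNNReal : ℝ) = s := Real.coe_toNNReal _ hs0
  have hst : s.toNNReal ≤ t := by
    rw [← NNReal.coe_le_coe, hsnn]; exact hs.2.trans (NNReal.coe_le_coe.2 hui1)
  have hsT : s ∈ Set.Icc (0 : ℝ) t := ⟨hs0, hs.2.trans (NNReal.coe_le_coe.2 hui1)⟩
  rw [Real.norm_eq_abs]
  refine hF s hsT _ (abs_le.1 (hM _ hui1)) s hsT _ (abs_le.1 (hM _ hst)) (by simp [hδ₁.le]) ?_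
  refine hxδ _ hui1 _ hst ?_
  rw [hsnn, abs_of_nonneg (sub_nonneg.2 hs.2)]
  linarith [hs.1]

/-! ### Riemann–Stieltjes sums against an absolutely continuous path -/

/-- **Left-point Riemann–Stieltjes sums against `V = ∫₀ b ds` converge to `∫ φ b ds`**,
quantitatively: for `φ` continuous on `ℝ≥0`, `b` integrable on `[0, t]` and `ε > 0` there is
`δ > 0` such that for every grid `u₀ ≤ ⋯ ≤ u_N` in `[0, t]` with cells `≤ δ`,
`|∑ᵢ φ(uᵢ) (V(uᵢ₊₁) - V(uᵢ)) - ∫_{u₀}^{u_N} φ(s⁺) b(s) ds| ≤ ε ∫_{u₀}^{u_N} |b(s)| ds`.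
Le Gall (2016), Lemma 4.3 / Thm 5.10 (the finite-variation part of `∫ F'(X) dX`);
Revuz–Yor (1999), Ch. IV, Thm (3.3), Remark 1°. [folklore] -/
theorem exists_forall_abs_sum_mul_incr_primitive_sub_le {φ : ℝ≥0 → ℝ} (hφ : Continuous φ)
    {b : ℝ → ℝ} (t : ℝ≥0) (hb : IntegrableOn b (Set.Icc (0 : ℝ) t)) {ε : ℝ} (hε : 0 < ε) :
    ∃ δ > 0, ∀ (N : ℕ) (u : ℕ → ℝ≥0), (∀ i ≤ N, u i ≤ t) →
      (∀ i < N, u i ≤ u (i + 1) ∧ (u (i + 1) : ℝ) - u i ≤ δ) →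
      |∑ i ∈ range N, φ (u i) * ((∫ s in (0 : ℝ)..(u (i + 1) : ℝ≥0), b s) -
          ∫ s in (0 : ℝ)..(u i : ℝ≥0), b s) -
          ∫ s in ((u 0 : ℝ≥0) : ℝ)..(u N : ℝ≥0), φ s.toNNReal * b s| ≤
        ε * ∫ s in ((u 0 : ℝ≥0) : ℝ)..(u N : ℝ≥0), |b s| := by
  obtain ⟨δ, hδ, hφδ⟩ := exists_forall_abs_sub_le_of_continuous hφ t hε
  refine ⟨δ, hδ, fun N u hut hu ↦ ?_⟩
  -- integrability on sub-intervals of `[0, t]`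
  have hbI : ∀ {a c : ℝ≥0}, a ≤ t → c ≤ t → IntervalIntegrable b volume (a : ℝ) c := by
    intro a c ha hc
    exact (hb.mono_set (Set.uIcc_subset_Icc ⟨a.coe_nonneg, NNReal.coe_le_coe.2 ha⟩
      ⟨c.coe_nonneg, NNReal.coe_le_coe.2 hc⟩)).intervalIntegrable
  have hφc : Continuous fun s : ℝ ↦ φ s.toNNReal := hφ.comp continuous_real_toNNReal
  have hφbI : ∀ {a c : ℝ≥0}, a ≤ t → c ≤ t →
      IntervalIntegrable (fun s ↦ φ s.toNNReal * b s) volume (a : ℝ) c := fun ha hc ↦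
    (hbI ha hc).continuousOn_mul hφc.continuousOn
  -- the cell increments of the primitive
  have hV : ∀ i ∈ range N, (∫ s in (0 : ℝ)..(u (i + 1) : ℝ≥0), b s) -
      ∫ s in (0 : ℝ)..(u i : ℝ≥0), b s = ∫ s in ((u i : ℝ≥0) : ℝ)..(u (i + 1) : ℝ≥0), b s := by
    intro i hi
    have hiN := mem_range.1 hi
    have h := integral_interval_sub_left (hbI (a := 0) zero_le (hut (i + 1) hiN))
      (hbI (a := 0) zero_le (hut i hiN.le))
    simpa using h
  rw [sum_congr rfl fun i hi ↦ by rw [hV i hi]]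
  -- split the integrals over the cells
  have hsplit := sum_integral_adjacent_intervals (μ := volume) (f := fun s ↦ φ s.toNNReal * b s)
    (a := fun i ↦ ((u i : ℝ≥0) : ℝ)) (n := N) (fun i hi ↦ hφbI (hut i hi.le) (hut (i + 1) hi))
  have hsplit' := sum_integral_adjacent_intervals (μ := volume) (f := fun s ↦ |b s|)
    (a := fun i ↦ ((u i : ℝ≥0) : ℝ)) (n := N) (fun i hi ↦ (hbI (hut i hi.le) (hut (i + 1) hi)).abs)
  rw [← hsplit, ← hsplit', ← sum_sub_distrib, mul_sum]
  refine (abs_sum_le_sum_abs _ _).trans (sum_le_sum fun i hi ↦ ?_)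
  have hiN : i < N := mem_range.1 hi
  obtain ⟨hmono, hcellδ⟩ := hu i hiN
  have hui : u i ≤ t := hut i hiN.le
  have hui1 : u (i + 1) ≤ t := hut (i + 1) hiN
  have hmono' : ((u i : ℝ≥0) : ℝ) ≤ u (i + 1) := NNReal.coe_le_coe.2 hmono
  rw [← intervalIntegral.integral_const_mul, ← intervalIntegral.integral_const_mul,
    ← integral_sub ((hbI hui hui1).continuousOn_mul continuousOn_const) (hφbI hui hui1)]
  rw [← Real.norm_eq_abs]
  refine norm_integral_le_of_norm_le hmono' (ae_of_all _ fun s hs ↦ ?_)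
    ((hbI hui hui1).abs.continuousOn_mul continuousOn_const)
  -- pointwise bound on the cell
  have hs0 : 0 ≤ s := (NNReal.coe_nonneg _).trans hs.1.le
  have hsnn : (s.toNNReal : ℝ) = s := Real.coe_toNNReal _ hs0
  have hst : s.toNNReal ≤ t := by
    rw [← NNReal.coe_le_coe, hsnn]; exact hs.2.trans (NNReal.coe_le_coe.2 hui1)
  rw [← sub_mul, norm_mul, Real.norm_eq_abs, Real.norm_eq_abs]
  refine mul_le_mul_of_nonneg_right (hφδ _ hui _ hst ?_) (abs_nonneg _)
  rw [hsnn, abs_of_nonpos (sub_nonpos.2 hs.1.le)]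
  linarith [hs.2]

/-! ### Quadratic sums: removing the finite-variation part -/

/-- **The finite-variation part does not contribute to quadratic sums.** Let
`x = x₀ + V + J` on `[0, t]` with `V = ∫₀ b ds`, `b` integrable on `[0, t]`, and `J` continuous.
For every bound `C` on the weights and every `ε > 0` there is `δ > 0` such that for every grid
`u₀ ≤ ⋯ ≤ u_N` in `[0, t]` with cells `≤ δ` and all weights `|wᵢ| ≤ C`,
`|∑ᵢ wᵢ (Δᵢx)² - ∑ᵢ wᵢ (ΔᵢJ)²| ≤ ε` and `∑ᵢ (ΔᵢV)² ≤ ε`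
(`(Δᵢx)² - (ΔᵢJ)² = ΔᵢV (ΔᵢV + 2 ΔᵢJ)`, `∑ |ΔᵢV| ≤ ∫ |b|`, and `max |ΔᵢV|, max |ΔᵢJ| → 0` by
uniform continuity).
Le Gall (2016), proof of Prop. 4.21 / Thm 5.10 (`⟨X, X⟩ = ⟨M, M⟩` for `X = M + V`);
Revuz–Yor (1999), Ch. IV, Def. (1.17)ff. [folklore] -/
theorem exists_forall_abs_quadSum_sub_quadSum_le {x V J : ℝ≥0 → ℝ} {t : ℝ≥0} {b : ℝ → ℝ}
    (hb : IntegrableOn b (Set.Icc (0 : ℝ) t)) (hV : ∀ s, V s = ∫ r in (0 : ℝ)..(s : ℝ≥0), b r)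
    (hdec : ∀ s ≤ t, x s = x 0 + V s + J s) (hJ : Continuous J) (C : ℝ) {ε : ℝ} (hε : 0 < ε) :
    ∃ δ > 0, ∀ (N : ℕ) (u : ℕ → ℝ≥0) (w : ℕ → ℝ), (∀ i, |w i| ≤ C) → (∀ i ≤ N, u i ≤ t) →
      (∀ i < N, u i ≤ u (i + 1) ∧ (u (i + 1) : ℝ) - u i ≤ δ) →
      |∑ i ∈ range N, w i * (x (u (i + 1)) - x (u i)) ^ 2 -
          ∑ i ∈ range N, w i * (J (u (i + 1)) - J (u i)) ^ 2| ≤ ε ∧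
      ∑ i ∈ range N, (V (u (i + 1)) - V (u i)) ^ 2 ≤ ε := by
  -- constants
  set L : ℝ := ∫ s in (0 : ℝ)..(t : ℝ≥0), |b s| with hL
  have hL0 : 0 ≤ L := intervalIntegral.integral_nonneg (NNReal.coe_nonneg t) fun s _ ↦ abs_nonneg _
  have hC0 : ∀ {N : ℕ} {w : ℕ → ℝ}, (∀ i, |w i| ≤ C) → 0 ≤ C := fun hw ↦ (abs_nonneg _).trans (hw 0)
  -- target oscillation `η`
  obtain ⟨η, hη, hη1, hη2⟩ : ∃ η : ℝ, 0 < η ∧ 3 * η * (|C| * L) ≤ ε ∧ η * L ≤ ε := by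
    set D : ℝ := 3 * (|C| + 1) * (L + 1) with hD
    have hD0 : 0 < D := by positivity
    refine ⟨ε / D, by positivity, ?_, ?_⟩
    · rw [show 3 * (ε / D) * (|C| * L) = ε * (3 * (|C| * L) / D) by ring]
      refine mul_le_of_le_one_right hε.le ((div_le_one hD0).2 ?_)
      rw [hD]; nlinarith [abs_nonneg C]
    · rw [show ε / D * L = ε * (L / D) by ring]
      refine mul_le_of_le_one_right hε.le ((div_le_one hD0).2 ?_)
      rw [hD]; nlinarith [abs_nonneg C]
  -- uniform continuity of `V` and `J` on `[0, t]`
  have hVc : ContinuousOn (fun s : ℝ ↦ ∫ r in (0 : ℝ)..s, b r) (Set.Icc (0 : ℝ) t) := by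
    have := continuousOn_primitive_interval (μ := volume) (a := (0 : ℝ)) (b := (t : ℝ))
      (by rwa [Set.uIcc_of_le (NNReal.coe_nonneg t)])
    rwa [Set.uIcc_of_le (NNReal.coe_nonneg t)] at this
  obtain ⟨δ₁, hδ₁, hVδ⟩ : ∃ δ₁ > 0, ∀ s ≤ t, ∀ s' ≤ t, |(s : ℝ) - s'| ≤ δ₁ → |V s - V s'| ≤ η := by
    obtain ⟨δ₁, hδ₁, h⟩ := Metric.uniformContinuousOn_iff_le.1
      (isCompact_Icc.uniformContinuousOn_of_continuous hVc) η hη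
    refine ⟨δ₁, hδ₁, fun s hs s' hs' hss' ↦ ?_⟩
    have := h (s : ℝ) ⟨s.coe_nonneg, NNReal.coe_le_coe.2 hs⟩ (s' : ℝ)
      ⟨s'.coe_nonneg, NNReal.coe_le_coe.2 hs'⟩ (by rwa [Real.dist_eq])
    rwa [Real.dist_eq, ← hV, ← hV] at this
  obtain ⟨δ₂, hδ₂, hJδ⟩ := exists_forall_abs_sub_le_of_continuous hJ t hη
  refine ⟨min δ₁ δ₂, lt_min hδ₁ hδ₂, fun N u w hw hut hu ↦ ?_⟩
  -- integrability on sub-intervals and `∑ |ΔᵢV| ≤ L`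
  have hbI : ∀ {a c : ℝ≥0}, a ≤ t → c ≤ t → IntervalIntegrable b volume (a : ℝ) c := by
    intro a c ha hc
    exact (hb.mono_set (Set.uIcc_subset_Icc ⟨a.coe_nonneg, NNReal.coe_le_coe.2 ha⟩
      ⟨c.coe_nonneg, NNReal.coe_le_coe.2 hc⟩)).intervalIntegrable
  have hΔV : ∀ i ∈ range N, |V (u (i + 1)) - V (u i)| ≤
      ∫ s in ((u i : ℝ≥0) : ℝ)..(u (i + 1) : ℝ≥0), |b s| := by
    intro i hi
    have hiN := mem_range.1 hi
    have h := integral_interval_sub_left (hbI (a := 0) zero_le (hut (i + 1) hiN))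
      (hbI (a := 0) zero_le (hut i hiN.le))
    simp only [NNReal.coe_zero] at h
    rw [hV, hV, h]
    exact abs_integral_le_integral_abs (NNReal.coe_le_coe.2 (hu i hiN).1)
  have hsumV : ∑ i ∈ range N, |V (u (i + 1)) - V (u i)| ≤ L := by
    refine (sum_le_sum hΔV).trans ?_
    rw [sum_integral_adjacent_intervals (μ := volume) (f := fun s ↦ |b s|)
      (a := fun i ↦ ((u i : ℝ≥0) : ℝ)) (n := N) (fun i hi ↦ (hbI (hut i hi.le) (hut (i + 1) hi)).abs)]
    -- `∫_{u₀}^{u_N} |b| ≤ ∫₀ᵗ |b|`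
    have h0N : u 0 ≤ u N := by
      suffices ∀ n ≤ N, u 0 ≤ u n from this N le_rfl
      intro n
      induction n with
      | zero => intro; exact le_rfl
      | succ n ih => intro hn; exact (ih (by omega)).trans (hu n (by omega)).1
    exact intervalIntegral.integral_mono_interval (NNReal.coe_nonneg _) (NNReal.coe_le_coe.2 h0N)
      (NNReal.coe_le_coe.2 (hut N le_rfl)) (ae_of_all _ fun s ↦ abs_nonneg _)
      (hbI (a := 0) zero_le le_rfl).abs
  -- oscillation bounds on the cells
  have hoscV : ∀ i ∈ range N, |V (u (i + 1)) - V (u i)| ≤ η := by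
    intro i hi
    have hiN := mem_range.1 hi
    refine hVδ _ (hut (i + 1) hiN) _ (hut i hiN.le) ?_
    rw [abs_of_nonneg (sub_nonneg.2 (NNReal.coe_le_coe.2 (hu i hiN).1))]
    exact (hu i hiN).2.trans (min_le_left _ _)
  have hoscJ : ∀ i ∈ range N, |J (u (i + 1)) - J (u i)| ≤ η := by
    intro i hi
    have hiN := mem_range.1 hi
    refine hJδ _ (hut (i + 1) hiN) _ (hut i hiN.le) ?_
    rw [abs_of_nonneg (sub_nonneg.2 (NNReal.coe_le_coe.2 (hu i hiN).1))]
    exact (hu i hiN).2.trans (min_le_right _ _)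
  constructor
  · -- the weighted sums
    rw [← sum_sub_distrib]
    have hcell : ∀ i ∈ range N, |w i * (x (u (i + 1)) - x (u i)) ^ 2 -
        w i * (J (u (i + 1)) - J (u i)) ^ 2| ≤ 3 * η * |C| * |V (u (i + 1)) - V (u i)| := by
      intro i hi
      have hiN := mem_range.1 hi
      have hx1 := hdec _ (hut (i + 1) hiN)
      have hx0 := hdec _ (hut i hiN.le)
      have heq : w i * (x (u (i + 1)) - x (u i)) ^ 2 - w i * (J (u (i + 1)) - J (u i)) ^ 2 =
          w i * ((V (u (i + 1)) - V (u i)) * ((V (u (i + 1)) - V (u i)) +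
            2 * (J (u (i + 1)) - J (u i)))) := by
        rw [hx1, hx0]; ring
      rw [heq, abs_mul, abs_mul]
      have h1 : |(V (u (i + 1)) - V (u i)) + 2 * (J (u (i + 1)) - J (u i))| ≤ 3 * η := by
        refine (abs_add_le _ _).trans ?_
        rw [abs_mul, abs_two]
        linarith [hoscV i hi, hoscJ i hi]
      have hwC : |w i| ≤ |C| := (hw i).trans (le_abs_self C)
      calc |w i| * (|V (u (i + 1)) - V (u i)| * |V (u (i + 1)) - V (u i) + 2 * (J (u (i + 1)) - J (u i))|)
          ≤ |C| * (|V (u (i + 1)) - V (u i)| * (3 * η)) := by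
            gcongr
        _ = 3 * η * |C| * |V (u (i + 1)) - V (u i)| := by ring
    calc |∑ i ∈ range N, (w i * (x (u (i + 1)) - x (u i)) ^ 2 - w i * (J (u (i + 1)) - J (u i)) ^ 2)|
        ≤ ∑ i ∈ range N, 3 * η * |C| * |V (u (i + 1)) - V (u i)| :=
          (abs_sum_le_sum_abs _ _).trans (sum_le_sum hcell)
      _ = 3 * η * |C| * ∑ i ∈ range N, |V (u (i + 1)) - V (u i)| := by rw [mul_sum]
      _ ≤ 3 * η * |C| * L := by gcongr
      _ = 3 * η * (|C| * L) := by ring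
      _ ≤ ε := hη1
  · -- `∑ (ΔᵢV)² ≤ η ∑ |ΔᵢV| ≤ η L ≤ ε`
    calc ∑ i ∈ range N, (V (u (i + 1)) - V (u i)) ^ 2
        ≤ ∑ i ∈ range N, η * |V (u (i + 1)) - V (u i)| := by
          refine sum_le_sum fun i hi ↦ ?_
          rw [← sq_abs, sq]
          exact mul_le_mul_of_nonneg_right (hoscV i hi) (abs_nonneg _)
      _ = η * ∑ i ∈ range N, |V (u (i + 1)) - V (u i)| := by rw [mul_sum]
      _ ≤ η * L := by gcongr
      _ ≤ ε := hη2

/-! ### The coarse dyadic grid of `[0, t]` and its partition of unity -/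

/-- The coarse grid points `rⱼ = t j / 2ⁿ` are nondecreasing in `j`. [folklore] -/
theorem uniformGrid_mono (t : ℝ≥0) (n : ℕ) {j j' : ℕ} (h : j ≤ j') :
    t * (j : ℝ≥0) / 2 ^ n ≤ t * (j' : ℝ≥0) / 2 ^ n := by
  gcongr

/-- The last coarse grid point is `t`. [folklore] -/
theorem uniformGrid_two_pow (t : ℝ≥0) (n : ℕ) : t * ((2 ^ n : ℕ) : ℝ≥0) / 2 ^ n = t := by
  rw [Nat.cast_pow, Nat.cast_ofNat, mul_div_assoc, div_self (pow_ne_zero n two_ne_zero), mul_one]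

/-- Consecutive coarse grid points are `t / 2ⁿ` apart. [folklore] -/
theorem uniformGrid_succ_sub (t : ℝ≥0) (n j : ℕ) :
    ((t * ((j + 1 : ℕ) : ℝ≥0) / 2 ^ n : ℝ≥0) : ℝ) - (t * (j : ℝ≥0) / 2 ^ n : ℝ≥0) = (t : ℝ) / 2 ^ n := by
  push_cast
  ring

/-- **Partition of unity of the coarse cells**: for `v : ℝ≥0`,
`∑_{j < 2ⁿ} 𝟙_{[rⱼ, rⱼ₊₁)}(v) = 𝟙_{[0, t)}(v)` with `rⱼ = t j / 2ⁿ` (telescoping of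
`𝟙_{[rⱼ, rⱼ₊₁)} = 𝟙_{[0, rⱼ₊₁)} - 𝟙_{[0, rⱼ)}`). [folklore] -/
theorem sum_indicator_Ico_uniformGrid (t : ℝ≥0) (n : ℕ) (v : ℝ≥0) :
    ∑ j ∈ range (2 ^ n), (Set.Ico (t * (j : ℝ≥0) / 2 ^ n) (t * ((j + 1 : ℕ) : ℝ≥0) / 2 ^ n)).indicator
        (1 : ℝ≥0 → ℝ) v = (Set.Iio t).indicator 1 v := by
  have hIco : ∀ {a c : ℝ≥0}, a ≤ c → (Set.Ico a c).indicator (1 : ℝ≥0 → ℝ) v =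
      (Set.Iio c).indicator 1 v - (Set.Iio a).indicator 1 v := by
    intro a c hac
    by_cases hva : v < a
    · rw [Set.indicator_of_mem (show v ∈ Set.Iio a from hva),
        Set.indicator_of_mem (show v ∈ Set.Iio c from hva.trans_le hac),
        Set.indicator_of_notMem (fun h ↦ (not_le.2 hva) h.1)]
      simp
    · push Not at hva
      rw [Set.indicator_of_notMem (show v ∉ Set.Iio a from not_lt.2 hva), sub_zero]
      by_cases hvc : v < c
      · rw [Set.indicator_of_mem (show v ∈ Set.Ico a c from ⟨hva, hvc⟩),
          Set.indicator_of_mem (show v ∈ Set.Iio c from hvc)]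
      · rw [Set.indicator_of_notMem (fun h ↦ hvc h.2),
          Set.indicator_of_notMem (show v ∉ Set.Iio c from hvc)]
  rw [sum_congr rfl fun j _ ↦ hIco (uniformGrid_mono t n (Nat.le_succ j)),
    sum_range_sub (fun j ↦ (Set.Iio (t * (j : ℝ≥0) / 2 ^ n)).indicator (1 : ℝ≥0 → ℝ) v),
    uniformGrid_two_pow]
  simp

/-! ### Two-scale comparison of weighted quadratic sums -/

/-- **Two-scale comparison.** Let `h` have modulus `η` at scale `t / 2ⁿ` on `[0, t]` and let
`u₀ ≤ ⋯ ≤ u_N` be any grid in `[0, t]`. Then the quadratic sum of `Y` weighted by `h(uᵢ)` differs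
from the sum over the coarse cells `[rⱼ, rⱼ₊₁)`, `rⱼ = t j / 2ⁿ`, of the unweighted quadratic sums
of the fine cells starting in them, weighted by `h(rⱼ)`, by at most `η ∑ᵢ (ΔᵢY)²`. This is the
quantitative form of the weak-convergence step of Le Gall's proof of Itô's formula
(`∫ F''(X_s) μₙ(ds) → ∫ F''(X_s) d⟨X, X⟩_s`).
Le Gall (2016), proof of Thm 5.10, display (5.16). [folklore] -/
theorem abs_quadSum_sub_twoScale_le {h Y : ℝ≥0 → ℝ} {t : ℝ≥0} (n : ℕ) {η : ℝ}
    (hmod : ∀ s ≤ t, ∀ s' ≤ t, |(s : ℝ) - s'| ≤ (t : ℝ) / 2 ^ n → |h s - h s'| ≤ η)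
    (N : ℕ) (u : ℕ → ℝ≥0) (hut : ∀ i ≤ N, u i ≤ t) (hu : ∀ i < N, u i ≤ u (i + 1)) :
    |∑ i ∈ range N, h (u i) * (Y (u (i + 1)) - Y (u i)) ^ 2 -
        ∑ j ∈ range (2 ^ n), h (t * (j : ℝ≥0) / 2 ^ n) * ∑ i ∈ range N,
          (Set.Ico (t * (j : ℝ≥0) / 2 ^ n) (t * ((j + 1 : ℕ) : ℝ≥0) / 2 ^ n)).indicator 1 (u i) *
            (Y (u (i + 1)) - Y (u i)) ^ 2| ≤
      η * ∑ i ∈ range N, (Y (u (i + 1)) - Y (u i)) ^ 2 := by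
  have hη0 : 0 ≤ η := (abs_nonneg _).trans (hmod 0 zero_le 0 zero_le (by simp; positivity))
  -- swap the sums and collect the coefficient of each fine cell
  simp_rw [mul_sum]
  rw [sum_comm, ← sum_sub_distrib]
  refine (abs_sum_le_sum_abs _ _).trans (sum_le_sum fun i hi ↦ ?_)
  have hiN : i < N := mem_range.1 hi
  have hcoef : h (u i) * (Y (u (i + 1)) - Y (u i)) ^ 2 -
      ∑ j ∈ range (2 ^ n), h (t * (j : ℝ≥0) / 2 ^ n) *
        ((Set.Ico (t * (j : ℝ≥0) / 2 ^ n) (t * ((j + 1 : ℕ) : ℝ≥0) / 2 ^ n)).indicator 1 (u i) *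
          (Y (u (i + 1)) - Y (u i)) ^ 2) =
      (h (u i) - ∑ j ∈ range (2 ^ n), h (t * (j : ℝ≥0) / 2 ^ n) *
        (Set.Ico (t * (j : ℝ≥0) / 2 ^ n) (t * ((j + 1 : ℕ) : ℝ≥0) / 2 ^ n)).indicator 1 (u i)) *
          (Y (u (i + 1)) - Y (u i)) ^ 2 := by
    rw [sub_mul, sum_mul]
    simp_rw [mul_assoc]
  rw [hcoef, abs_mul, abs_of_nonneg (sq_nonneg (Y (u (i + 1)) - Y (u i)))]
  -- either `uᵢ < t` (partition of unity) or the cell is degenerate (`uᵢ = uᵢ₊₁ = t`)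
  rcases (hut i hiN.le).lt_or_eq with hlt | heq
  swap
  · have hi1 : u (i + 1) = t := le_antisymm (hut (i + 1) hiN) (heq ▸ hu i hiN)
    rw [hi1, heq, sub_self]
    simp
  refine mul_le_mul_of_nonneg_right ?_ (sq_nonneg _)
  have hpu := sum_indicator_Ico_uniformGrid t n (u i)
  rw [Set.indicator_of_mem (show u i ∈ Set.Iio t from hlt), Pi.one_apply] at hpu
  have hrepr : h (u i) = ∑ j ∈ range (2 ^ n), h (u i) *
      (Set.Ico (t * (j : ℝ≥0) / 2 ^ n) (t * ((j + 1 : ℕ) : ℝ≥0) / 2 ^ n)).indicator 1 (u i) := by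
    rw [← mul_sum, hpu, mul_one]
  rw [hrepr, ← sum_sub_distrib]
  refine (abs_sum_le_sum_abs _ _).trans ?_
  calc ∑ j ∈ range (2 ^ n), |h (u i) *
        (Set.Ico (t * (j : ℝ≥0) / 2 ^ n) (t * ((j + 1 : ℕ) : ℝ≥0) / 2 ^ n)).indicator 1 (u i) -
          h (t * (j : ℝ≥0) / 2 ^ n) *
        (Set.Ico (t * (j : ℝ≥0) / 2 ^ n) (t * ((j + 1 : ℕ) : ℝ≥0) / 2 ^ n)).indicator 1 (u i)|
      ≤ ∑ j ∈ range (2 ^ n), η *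
        (Set.Ico (t * (j : ℝ≥0) / 2 ^ n) (t * ((j + 1 : ℕ) : ℝ≥0) / 2 ^ n)).indicator 1 (u i) := by
        refine sum_le_sum fun j hj ↦ ?_
        rw [← sub_mul]
        by_cases hmem : u i ∈ Set.Ico (t * (j : ℝ≥0) / 2 ^ n) (t * ((j + 1 : ℕ) : ℝ≥0) / 2 ^ n)
        · rw [Set.indicator_of_mem hmem, Pi.one_apply, mul_one, mul_one]
          have hj2 : j + 1 ≤ 2 ^ n := mem_range.1 hj
          have hrt : t * (j : ℝ≥0) / 2 ^ n ≤ t := by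
            calc t * (j : ℝ≥0) / 2 ^ n ≤ t * ((2 ^ n : ℕ) : ℝ≥0) / 2 ^ n :=
                  uniformGrid_mono t n (by omega)
              _ = t := uniformGrid_two_pow t n
          refine hmod _ (hut i hiN.le) _ hrt ?_
          rw [abs_of_nonneg (sub_nonneg.2 (NNReal.coe_le_coe.2 hmem.1))]
          have h2 := NNReal.coe_le_coe.2 hmem.2.le
          have h3 := uniformGrid_succ_sub t n j
          linarith
        · rw [Set.indicator_of_notMem hmem, mul_zero, mul_zero, abs_zero]
    _ = η := by rw [← mul_sum, hpu, mul_one]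

/-- The coarse grid points lie in `[0, t]`. [folklore] -/
theorem uniformGrid_le (t : ℝ≥0) (n : ℕ) {j : ℕ} (hj : j ≤ 2 ^ n) : t * (j : ℝ≥0) / 2 ^ n ≤ t :=
  calc t * (j : ℝ≥0) / 2 ^ n ≤ t * ((2 ^ n : ℕ) : ℝ≥0) / 2 ^ n := uniformGrid_mono t n hj
    _ = t := uniformGrid_two_pow t n

/-- **Coarse Riemann sums of `∫ h q`.** If `h` has modulus `η` at scale `t / 2ⁿ` on `[0, t]`,
`h` is continuous and `q` is integrable on `[0, t]`, then
`|∑ⱼ h(rⱼ) ∫_{rⱼ}^{rⱼ₊₁} q - ∫₀ᵗ h(s⁺) q(s) ds| ≤ η ∫₀ᵗ |q|`, `rⱼ = t j / 2ⁿ`.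
Le Gall (2016), proof of Thm 5.10 (the limit measure `𝟙_{[0,t]} d⟨X, X⟩`). [folklore] -/
theorem abs_sum_mul_integral_sub_integral_le {h : ℝ≥0 → ℝ} (hh : Continuous h) {q : ℝ → ℝ}
    {t : ℝ≥0} (n : ℕ) {η : ℝ}
    (hmod : ∀ s ≤ t, ∀ s' ≤ t, |(s : ℝ) - s'| ≤ (t : ℝ) / 2 ^ n → |h s - h s'| ≤ η)
    (hq : IntegrableOn q (Set.Icc (0 : ℝ) t)) :
    |∑ j ∈ range (2 ^ n), h (t * (j : ℝ≥0) / 2 ^ n) *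
        (∫ s in ((t * (j : ℝ≥0) / 2 ^ n : ℝ≥0) : ℝ)..((t * ((j + 1 : ℕ) : ℝ≥0) / 2 ^ n : ℝ≥0) : ℝ),
          q s) -
      ∫ s in (0 : ℝ)..(t : ℝ), h s.toNNReal * q s| ≤ η * ∫ s in (0 : ℝ)..(t : ℝ), |q s| := by
  -- integrability on sub-intervals of `[0, t]`
  have hqI : ∀ {a c : ℝ≥0}, a ≤ t → c ≤ t → IntervalIntegrable q volume (a : ℝ) c := by
    intro a c ha hc
    exact (hq.mono_set (Set.uIcc_subset_Icc ⟨a.coe_nonneg, NNReal.coe_le_coe.2 ha⟩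
      ⟨c.coe_nonneg, NNReal.coe_le_coe.2 hc⟩)).intervalIntegrable
  have hhc : Continuous fun s : ℝ ↦ h s.toNNReal := hh.comp continuous_real_toNNReal
  have hhqI : ∀ {a c : ℝ≥0}, a ≤ t → c ≤ t →
      IntervalIntegrable (fun s ↦ h s.toNNReal * q s) volume (a : ℝ) c := fun ha hc ↦
    (hqI ha hc).continuousOn_mul hhc.continuousOn
  -- the coarse grid as a real sequence
  set r : ℕ → ℝ≥0 := fun j ↦ t * (j : ℝ≥0) / 2 ^ n with hr
  have hr0 : ((r 0 : ℝ≥0) : ℝ) = 0 := by simp [hr]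
  have hrN : r (2 ^ n) = t := by
    simp only [hr]
    exact_mod_cast uniformGrid_two_pow t n
  have hrle : ∀ {j}, j ≤ 2 ^ n → r j ≤ t := fun hj ↦ uniformGrid_le t n hj
  have hsplit := sum_integral_adjacent_intervals (μ := volume) (f := fun s ↦ h s.toNNReal * q s)
    (a := fun j ↦ ((r j : ℝ≥0) : ℝ)) (n := 2 ^ n)
    (fun j hj ↦ hhqI (hrle hj.le) (hrle (Nat.succ_le_of_lt hj)))
  have hsplit' := sum_integral_adjacent_intervals (μ := volume) (f := fun s ↦ |q s|)
    (a := fun j ↦ ((r j : ℝ≥0) : ℝ)) (n := 2 ^ n)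
    (fun j hj ↦ (hqI (hrle hj.le) (hrle (Nat.succ_le_of_lt hj))).abs)
  simp only [hr0, hrN] at hsplit hsplit'
  change |∑ j ∈ range (2 ^ n), h (r j) * (∫ s in ((r j : ℝ≥0) : ℝ)..((r (j + 1) : ℝ≥0) : ℝ), q s) -
      ∫ s in (0 : ℝ)..(t : ℝ), h s.toNNReal * q s| ≤ η * ∫ s in (0 : ℝ)..(t : ℝ), |q s|
  rw [← hsplit, ← hsplit', ← sum_sub_distrib, mul_sum]
  refine (abs_sum_le_sum_abs _ _).trans (sum_le_sum fun j hj ↦ ?_)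
  have hj2 : j < 2 ^ n := mem_range.1 hj
  have hrj : r j ≤ t := hrle hj2.le
  have hrj1 : r (j + 1) ≤ t := hrle (Nat.succ_le_of_lt hj2)
  have hmono' : ((r j : ℝ≥0) : ℝ) ≤ r (j + 1) := NNReal.coe_le_coe.2 (uniformGrid_mono t n (Nat.le_succ j))
  rw [← intervalIntegral.integral_const_mul, ← intervalIntegral.integral_const_mul,
    ← integral_sub ((hqI hrj hrj1).continuousOn_mul continuousOn_const) (hhqI hrj hrj1)]
  rw [← Real.norm_eq_abs]
  refine norm_integral_le_of_norm_le hmono' (ae_of_all _ fun s hs ↦ ?_)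
    ((hqI hrj hrj1).abs.continuousOn_mul continuousOn_const)
  have hs0 : 0 ≤ s := (NNReal.coe_nonneg _).trans hs.1.le
  have hsnn : (s.toNNReal : ℝ) = s := Real.coe_toNNReal _ hs0
  have hst : s.toNNReal ≤ t := by
    rw [← NNReal.coe_le_coe, hsnn]; exact hs.2.trans (NNReal.coe_le_coe.2 hrj1)
  rw [← sub_mul, norm_mul, Real.norm_eq_abs, Real.norm_eq_abs]
  refine mul_le_mul_of_nonneg_right (hmod _ hrj _ hst ?_) (abs_nonneg _)
  rw [hsnn, abs_of_nonpos (sub_nonpos.2 hs.1.le)]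
  have := uniformGrid_succ_sub t n j
  simp only [hr] at hs
  linarith [hs.2]

/-- A coarse cell sum is a difference of two initial-segment sums:
`𝟙_{[a, c)} = 𝟙_{[0, c)} - 𝟙_{[0, a)}` on `ℝ≥0` for `a ≤ c`. [folklore] -/
theorem indicator_Ico_eq_sub {a c : ℝ≥0} (hac : a ≤ c) (v : ℝ≥0) :
    (Set.Ico a c).indicator (1 : ℝ≥0 → ℝ) v =
      (Set.Iio c).indicator 1 v - (Set.Iio a).indicator 1 v := by
  by_cases hva : v < a
  · rw [Set.indicator_of_mem (show v ∈ Set.Iio a from hva),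
      Set.indicator_of_mem (show v ∈ Set.Iio c from hva.trans_le hac),
      Set.indicator_of_notMem (fun h ↦ (not_le.2 hva) h.1)]
    simp
  · push Not at hva
    rw [Set.indicator_of_notMem (show v ∉ Set.Iio a from not_lt.2 hva), sub_zero]
    by_cases hvc : v < c
    · rw [Set.indicator_of_mem (show v ∈ Set.Ico a c from ⟨hva, hvc⟩),
        Set.indicator_of_mem (show v ∈ Set.Iio c from hvc)]
    · rw [Set.indicator_of_notMem (fun h ↦ hvc h.2),
        Set.indicator_of_notMem (show v ∉ Set.Iio c from hvc)]

/-! ### Passing to the limit along a sequence of grids -/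

section Limits

variable {t : ℝ≥0} {v : ℕ → ℕ → ℝ≥0} {N : ℕ → ℕ}

/-- On a grid in `[0, t]`, restricting a quadratic sum to the cells starting before `t` changes
nothing (the other cells are degenerate). [folklore] -/
theorem sum_indicator_Iio_mul_sq_eq {Y : ℝ≥0 → ℝ} {M : ℕ} {u : ℕ → ℝ≥0} (hut : ∀ i ≤ M, u i ≤ t)
    (hu : ∀ i < M, u i ≤ u (i + 1)) :
    ∑ i ∈ range M, (Set.Iio t).indicator (1 : ℝ≥0 → ℝ) (u i) * (Y (u (i + 1)) - Y (u i)) ^ 2 =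
      ∑ i ∈ range M, (Y (u (i + 1)) - Y (u i)) ^ 2 := by
  refine sum_congr rfl fun i hi ↦ ?_
  have hiM := mem_range.1 hi
  rcases (hut i hiM.le).lt_or_eq with hlt | heq
  · rw [Set.indicator_of_mem (show u i ∈ Set.Iio t from hlt), Pi.one_apply, one_mul]
  · have hi1 : u (i + 1) = t := le_antisymm (hut (i + 1) hiM) (heq ▸ hu i hiM)
    rw [hi1, heq, sub_self]
    simp

/-- **Weighted quadratic sums from unweighted ones on coarse cells** (the limit form of the
two-scale comparison). Along a sequence of grids `v j` of `[0, t]`, if for every coarse level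
`n₀` and every `l ≤ 2^{n₀}` the quadratic sums of `J` over the cells starting in `[0, t l / 2^{n₀})`
converge to `∫₀^{t l / 2^{n₀}} q`, then for every continuous weight `h` the `h`-weighted quadratic
sums converge to `∫₀ᵗ h q`.
Le Gall (2016), proof of Thm 5.10, display (5.16) (weak convergence of `μₙ` to
`𝟙_{[0,t]} d⟨X, X⟩` tested against `F''(X_s)`). [folklore] -/
theorem tendsto_weightedQuadSum_of_tendsto_coarse {h : ℝ≥0 → ℝ} (hh : Continuous h)
    {J : ℝ≥0 → ℝ} {q : ℝ → ℝ} (hq : IntegrableOn q (Set.Icc (0 : ℝ) t))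
    (hvt : ∀ j, ∀ i ≤ N j, v j i ≤ t) (hvmono : ∀ j, ∀ i < N j, v j i ≤ v j (i + 1))
    (hlim : ∀ n₀ l : ℕ, l ≤ 2 ^ n₀ → Tendsto (fun j ↦ ∑ i ∈ range (N j),
      (Set.Iio (t * (l : ℝ≥0) / 2 ^ n₀)).indicator (1 : ℝ≥0 → ℝ) (v j i) *
        (J (v j (i + 1)) - J (v j i)) ^ 2) atTop
      (𝓝 (∫ s in (0 : ℝ)..((t * (l : ℝ≥0) / 2 ^ n₀ : ℝ≥0) : ℝ), q s))) :
    Tendsto (fun j ↦ ∑ i ∈ range (N j), h (v j i) * (J (v j (i + 1)) - J (v j i)) ^ 2) atTop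
      (𝓝 (∫ s in (0 : ℝ)..(t : ℝ), h s.toNNReal * q s)) := by
  set Qt : ℝ := ∫ s in (0 : ℝ)..(t : ℝ), q s with hQt
  set L : ℝ := ∫ s in (0 : ℝ)..(t : ℝ), |q s| with hL
  have hL0 : 0 ≤ L := intervalIntegral.integral_nonneg (NNReal.coe_nonneg t) fun s _ ↦ abs_nonneg _
  -- the unweighted sums converge to `Qt`
  have hQS : Tendsto (fun j ↦ ∑ i ∈ range (N j), (J (v j (i + 1)) - J (v j i)) ^ 2) atTop (𝓝 Qt) := by
    have h1 := hlim 0 1 (le_refl _)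
    simp only [pow_zero, Nat.cast_one, mul_one, div_one] at h1
    refine h1.congr fun j ↦ ?_
    exact sum_indicator_Iio_mul_sq_eq (hvt j) (hvmono j)
  rw [Metric.tendsto_atTop]
  intro ε hε
  -- the oscillation target
  obtain ⟨η, hη, hηε⟩ : ∃ η : ℝ, 0 < η ∧ η * (|Qt| + 1) + η * L ≤ ε / 3 := by
    refine ⟨ε / 3 / (|Qt| + 1 + L + 1), by positivity, ?_⟩
    rw [← mul_add, div_mul_eq_mul_div, div_le_iff₀ (by positivity)]
    have : |Qt| + 1 + L ≤ |Qt| + 1 + L + 1 := by linarith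
    exact mul_le_mul_of_nonneg_left this (by positivity)
  -- uniform continuity of `h` at scale `t / 2^{n₀}`
  obtain ⟨δ, hδ, hhδ⟩ := exists_forall_abs_sub_le_of_continuous hh t hη
  obtain ⟨n₀, hn₀⟩ : ∃ n₀ : ℕ, (t : ℝ) / 2 ^ n₀ ≤ δ := by
    obtain ⟨n₀, hn₀⟩ := exists_pow_lt_of_lt_one (div_pos hδ (lt_of_lt_of_le one_pos
      (le_max_right (t : ℝ) 1))) (show (1 : ℝ) / 2 < 1 by norm_num)
    refine ⟨n₀, ?_⟩
    rw [div_le_iff₀ (pow_pos two_pos n₀)]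
    have h1 : ((1 : ℝ) / 2) ^ n₀ * max (t : ℝ) 1 < δ := by
      rwa [lt_div_iff₀ (lt_of_lt_of_le one_pos (le_max_right (t : ℝ) 1))] at hn₀
    have h2 : (t : ℝ) ≤ max (t : ℝ) 1 := le_max_left _ _
    have h3 : (0 : ℝ) < 2 ^ n₀ := pow_pos two_pos n₀
    calc (t : ℝ) = ((1 : ℝ) / 2) ^ n₀ * (t : ℝ) * 2 ^ n₀ := by
          rw [div_pow, one_pow]; field_simp
      _ ≤ ((1 : ℝ) / 2) ^ n₀ * max (t : ℝ) 1 * 2 ^ n₀ := by gcongr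
      _ ≤ δ * 2 ^ n₀ := by nlinarith
  have hmod : ∀ s ≤ t, ∀ s' ≤ t, |(s : ℝ) - s'| ≤ (t : ℝ) / 2 ^ n₀ → |h s - h s'| ≤ η :=
    fun s hs s' hs' hss' ↦ hhδ s hs s' hs' (hss'.trans hn₀)
  -- the coarse grid and the block sums
  set r : ℕ → ℝ≥0 := fun l ↦ t * (l : ℝ≥0) / 2 ^ n₀ with hr
  have hrle : ∀ {l}, l ≤ 2 ^ n₀ → r l ≤ t := fun hl ↦ uniformGrid_le t n₀ hl
  have hqI : ∀ {a c : ℝ≥0}, a ≤ t → c ≤ t → IntervalIntegrable q volume (a : ℝ) c := by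
    intro a c ha hc
    exact (hq.mono_set (Set.uIcc_subset_Icc ⟨a.coe_nonneg, NNReal.coe_le_coe.2 ha⟩
      ⟨c.coe_nonneg, NNReal.coe_le_coe.2 hc⟩)).intervalIntegrable
  -- block sums converge to the block integrals
  have hblock : ∀ l < 2 ^ n₀, Tendsto (fun j ↦ ∑ i ∈ range (N j),
      (Set.Ico (r l) (r (l + 1))).indicator (1 : ℝ≥0 → ℝ) (v j i) * (J (v j (i + 1)) - J (v j i)) ^ 2)
      atTop (𝓝 (∫ s in ((r l : ℝ≥0) : ℝ)..((r (l + 1) : ℝ≥0) : ℝ), q s)) := by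
    intro l hl
    have hsub : (∫ s in ((r l : ℝ≥0) : ℝ)..((r (l + 1) : ℝ≥0) : ℝ), q s) =
        (∫ s in (0 : ℝ)..((r (l + 1) : ℝ≥0) : ℝ), q s) - ∫ s in (0 : ℝ)..((r l : ℝ≥0) : ℝ), q s := by
      have h := integral_interval_sub_left (hqI (a := 0) zero_le (hrle (Nat.succ_le_of_lt hl)))
        (hqI (a := 0) zero_le (hrle hl.le))
      simp only [NNReal.coe_zero] at h
      exact h.symm
    rw [hsub]
    have hl1 := hlim n₀ (l + 1) (Nat.succ_le_of_lt hl)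
    have hl0 := hlim n₀ l hl.le
    refine (hl1.sub hl0).congr fun j ↦ ?_
    rw [← sum_sub_distrib]
    refine sum_congr rfl fun i _ ↦ ?_
    rw [← sub_mul, indicator_Ico_eq_sub (uniformGrid_mono t n₀ (Nat.le_succ l))]
  have hA : Tendsto (fun j ↦ ∑ l ∈ range (2 ^ n₀), h (r l) * ∑ i ∈ range (N j),
      (Set.Ico (r l) (r (l + 1))).indicator (1 : ℝ≥0 → ℝ) (v j i) * (J (v j (i + 1)) - J (v j i)) ^ 2)
      atTop (𝓝 (∑ l ∈ range (2 ^ n₀), h (r l) *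
        ∫ s in ((r l : ℝ≥0) : ℝ)..((r (l + 1) : ℝ≥0) : ℝ), q s)) :=
    tendsto_finsetSum _ fun l hl ↦ (hblock l (mem_range.1 hl)).const_mul _
  -- choose `j` large
  rw [Metric.tendsto_atTop] at hA hQS
  obtain ⟨j₁, hj₁⟩ := hA (ε / 3) (by positivity)
  obtain ⟨j₂, hj₂⟩ := hQS 1 one_pos
  refine ⟨max j₁ j₂, fun j hj ↦ ?_⟩
  have hj1 := hj₁ j ((le_max_left _ _).trans hj)
  have hj2 := hj₂ j ((le_max_right _ _).trans hj)
  rw [Real.dist_eq] at hj1 hj2 ⊢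
  -- two-scale comparison on the grid `v j` and on the integral side
  have h2s := abs_quadSum_sub_twoScale_le (h := h) (Y := J) n₀ hmod (N j) (v j) (hvt j) (hvmono j)
  have hint := abs_sum_mul_integral_sub_integral_le hh n₀ hmod hq
  have hQSb : ∑ i ∈ range (N j), (J (v j (i + 1)) - J (v j i)) ^ 2 ≤ |Qt| + 1 := by
    have := abs_sub_lt_iff.1 hj2
    linarith [le_abs_self Qt]
  -- combine
  have hcast : ∀ l, (t * ((l + 1 : ℕ) : ℝ≥0) / 2 ^ n₀ : ℝ≥0) = r (l + 1) := fun l ↦ rfl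
  simp only [hcast] at h2s hint
  calc |∑ i ∈ range (N j), h (v j i) * (J (v j (i + 1)) - J (v j i)) ^ 2 -
        ∫ s in (0 : ℝ)..(t : ℝ), h s.toNNReal * q s|
      ≤ |∑ i ∈ range (N j), h (v j i) * (J (v j (i + 1)) - J (v j i)) ^ 2 -
          ∑ l ∈ range (2 ^ n₀), h (r l) * ∑ i ∈ range (N j),
            (Set.Ico (r l) (r (l + 1))).indicator (1 : ℝ≥0 → ℝ) (v j i) *
              (J (v j (i + 1)) - J (v j i)) ^ 2| +
        |∑ l ∈ range (2 ^ n₀), h (r l) * ∑ i ∈ range (N j),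
            (Set.Ico (r l) (r (l + 1))).indicator (1 : ℝ≥0 → ℝ) (v j i) *
              (J (v j (i + 1)) - J (v j i)) ^ 2 -
          ∑ l ∈ range (2 ^ n₀), h (r l) * ∫ s in ((r l : ℝ≥0) : ℝ)..((r (l + 1) : ℝ≥0) : ℝ), q s| +
        |∑ l ∈ range (2 ^ n₀), h (r l) * (∫ s in ((r l : ℝ≥0) : ℝ)..((r (l + 1) : ℝ≥0) : ℝ), q s) -
          ∫ s in (0 : ℝ)..(t : ℝ), h s.toNNReal * q s| := by
        have tri : ∀ a b c d : ℝ, |a - d| ≤ |a - b| + |b - c| + |c - d| := fun a b c d ↦ by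
          linarith [abs_sub_le a b d, abs_sub_le b c d]
        exact tri _ _ _ _
    _ ≤ η * ∑ i ∈ range (N j), (J (v j (i + 1)) - J (v j i)) ^ 2 + ε / 3 + η * L :=
        add_le_add_three h2s hj1.le hint
    _ ≤ η * (|Qt| + 1) + ε / 3 + η * L := by gcongr
    _ < ε := by linarith

/-- From a quantitative mesh statement to a limit along grids with mesh `→ 0`. [folklore] -/
theorem tendsto_of_forall_mesh {a : ℕ → ℝ} {A : ℝ} {c : ℝ} (hc : 0 ≤ c)
    (hδv : ∀ j, ∀ i < N j, v j i ≤ v j (i + 1)) {δ : ℕ → ℝ} (hδ : Tendsto δ atTop (𝓝 0))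
    (hmesh : ∀ j, ∀ i < N j, (v j (i + 1) : ℝ) - v j i ≤ δ j)
    (h : ∀ ε > 0, ∃ δ₀ > 0, ∀ j, (∀ i < N j, v j i ≤ v j (i + 1) ∧ (v j (i + 1) : ℝ) - v j i ≤ δ₀) →
      |a j - A| ≤ ε * c) :
    Tendsto a atTop (𝓝 A) := by
  rw [Metric.tendsto_atTop]
  intro ε hε
  obtain ⟨δ₀, hδ₀, hj⟩ := h (ε / (c + 1)) (by positivity)
  obtain ⟨j₀, hj₀⟩ := Metric.tendsto_atTop.1 hδ δ₀ hδ₀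
  refine ⟨j₀, fun j hjj ↦ ?_⟩
  have hδj : δ j ≤ δ₀ := by
    have := hj₀ j hjj
    rw [Real.dist_eq, sub_zero] at this
    exact (le_abs_self _).trans this.le
  have := hj j fun i hi ↦ ⟨hδv j i hi, (hmesh j i hi).trans hδj⟩
  rw [Real.dist_eq]
  calc |a j - A| ≤ ε / (c + 1) * c := this
    _ < ε := by
        rw [div_mul_eq_mul_div, div_lt_iff₀ (by positivity)]
        nlinarith

/-- **Itô's formula along one path, given the limits of the Riemann and quadratic sums of the
martingale part.** Let `f(s, ·)` have derivatives `g, h` (first, second) and `∂ₛf = k`, all jointly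
continuous; let `x = x₀ + V + J` on `[0, t]` with `V = ∫₀ b`, `J` continuous, and let `q` be
integrable on `[0, t]`. Along grids `v j` of `[0, t]` (from `0` to `t`, mesh `→ 0`), assume that the
left-point Riemann sums `∑ᵢ g(vᵢ, xᵢ) ΔᵢJ` converge to `κ` and that for all coarse dyadic
`r = t l / 2^{n₀}` the quadratic sums `∑_{vᵢ < r} (ΔᵢJ)²` converge to `∫₀ʳ q`. Then
`f(t, x_t) = f(0, x_0) + ∫₀ᵗ (k + b g + ½ q h)(s, x_s) ds + κ`.
This is the deterministic skeleton of the Taylor-expansion proof of Itô's formula: the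
stochastic inputs (`κ = (∫ g σ dB)_t`, `q = σ²`) enter only through the two limit hypotheses.
Le Gall (2016), Thm 5.10 (proof); Revuz–Yor (1999), Ch. IV, Thm (3.3) and Remark 1°. [folklore] -/
theorem ito_formula_path_of_tendsto {f g h k : ℝ → ℝ → ℝ}
    (hg : ∀ s y, HasDerivAt (f s) (g s y) y) (hh : ∀ s y, HasDerivAt (g s) (h s y) y)
    (hk : ∀ s y, HasDerivAt (fun r ↦ f r y) (k s y) s)
    (hgc : Continuous (Function.uncurry g)) (hhc : Continuous (Function.uncurry h))
    (hkc : Continuous (Function.uncurry k))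
    {x V J : ℝ≥0 → ℝ} {b q : ℝ → ℝ} (hx : Continuous x) (hJ : Continuous J)
    (hb : IntegrableOn b (Set.Icc (0 : ℝ) t)) (hq : IntegrableOn q (Set.Icc (0 : ℝ) t))
    (hV : ∀ s, V s = ∫ r in (0 : ℝ)..(s : ℝ≥0), b r) (hdec : ∀ s ≤ t, x s = x 0 + V s + J s)
    (hvt : ∀ j, ∀ i ≤ N j, v j i ≤ t) (hvmono : ∀ j, ∀ i < N j, v j i ≤ v j (i + 1))
    (hv0 : ∀ j, v j 0 = 0) (hvN : ∀ j, v j (N j) = t)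
    {δ : ℕ → ℝ} (hδ : Tendsto δ atTop (𝓝 0)) (hmesh : ∀ j, ∀ i < N j, (v j (i + 1) : ℝ) - v j i ≤ δ j)
    {κ : ℝ} (hRS : Tendsto (fun j ↦ ∑ i ∈ range (N j),
      g (v j i) (x (v j i)) * (J (v j (i + 1)) - J (v j i))) atTop (𝓝 κ))
    (hQS : ∀ n₀ l : ℕ, l ≤ 2 ^ n₀ → Tendsto (fun j ↦ ∑ i ∈ range (N j),
      (Set.Iio (t * (l : ℝ≥0) / 2 ^ n₀)).indicator (1 : ℝ≥0 → ℝ) (v j i) *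
        (J (v j (i + 1)) - J (v j i)) ^ 2) atTop
      (𝓝 (∫ s in (0 : ℝ)..((t * (l : ℝ≥0) / 2 ^ n₀ : ℝ≥0) : ℝ), q s))) :
    f t (x t) = f 0 (x 0) +
      (∫ s in (0 : ℝ)..(t : ℝ), (k s (x s.toNNReal) + b s * g (s.toNNReal : ℝ) (x s.toNNReal) +
        2⁻¹ * q s * h (s.toNNReal : ℝ) (x s.toNNReal))) + κ := by
  -- the five sequences
  set T1 : ℕ → ℝ := fun j ↦ ∑ i ∈ range (N j),
    (f (v j (i + 1)) (x (v j (i + 1))) - f (v j i) (x (v j (i + 1)))) with hT1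
  set RSV : ℕ → ℝ := fun j ↦ ∑ i ∈ range (N j),
    g (v j i) (x (v j i)) * (V (v j (i + 1)) - V (v j i)) with hRSV
  set RSJ : ℕ → ℝ := fun j ↦ ∑ i ∈ range (N j),
    g (v j i) (x (v j i)) * (J (v j (i + 1)) - J (v j i)) with hRSJ
  set QSx : ℕ → ℝ := fun j ↦ ∑ i ∈ range (N j),
    h (v j i) (x (v j i)) * (x (v j (i + 1)) - x (v j i)) ^ 2 with hQSx
  set QSJ : ℕ → ℝ := fun j ↦ ∑ i ∈ range (N j),
    h (v j i) (x (v j i)) * (J (v j (i + 1)) - J (v j i)) ^ 2 with hQSJ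
  set Rem : ℕ → ℝ := fun j ↦ ∑ i ∈ range (N j),
    (f (v j i) (x (v j (i + 1))) - f (v j i) (x (v j i)) -
      g (v j i) (x (v j i)) * (x (v j (i + 1)) - x (v j i)) -
      2⁻¹ * h (v j i) (x (v j i)) * (x (v j (i + 1)) - x (v j i)) ^ 2) with hRem
  -- Step 1: exact decomposition for every `j`
  have hdecomp : ∀ j, f t (x t) - f 0 (x 0) = T1 j + (RSV j + RSJ j) + 2⁻¹ * QSx j + Rem j := by
    intro j
    have htel : f t (x t) - f 0 (x 0) = ∑ i ∈ range (N j),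
        (f (v j (i + 1)) (x (v j (i + 1))) - f (v j i) (x (v j i))) := by
      rw [sum_range_sub (fun i ↦ f (v j i) (x (v j i))), hvN, hv0, NNReal.coe_zero]
    rw [htel]
    simp only [hT1, hRSV, hRSJ, hQSx, hRem, ← sum_add_distrib, mul_sum]
    refine sum_congr rfl fun i hi ↦ ?_
    have hiN := mem_range.1 hi
    have hx1 := hdec _ (hvt j (i + 1) hiN)
    have hx0 := hdec _ (hvt j i hiN.le)
    have hΔ : x (v j (i + 1)) - x (v j i) =
        (V (v j (i + 1)) - V (v j i)) + (J (v j (i + 1)) - J (v j i)) := by rw [hx1, hx0]; ring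
    rw [hΔ]
    ring
  -- Step 2: the limits
  have hx' : Continuous fun s : ℝ ↦ x s.toNNReal := hx.comp continuous_real_toNNReal
  -- (a) time increments
  have hT1lim : Tendsto T1 atTop (𝓝 (∫ s in (0 : ℝ)..(t : ℝ), k s (x s.toNNReal))) := by
    refine tendsto_of_forall_mesh (NNReal.coe_nonneg t) hvmono hδ hmesh fun ε hε ↦ ?_
    obtain ⟨δ₀, hδ₀, hb⟩ := exists_forall_abs_sum_timeIncr_sub_integral_le hk hkc hx t hε
    refine ⟨δ₀, hδ₀, fun j hj ↦ ?_⟩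
    have := hb (N j) (v j) (hvt j) hj
    rwa [hv0, hvN, NNReal.coe_zero, sub_zero] at this
  -- (b) Riemann sums against `V`
  have hφc : Continuous fun u : ℝ≥0 ↦ g u (x u) :=
    hgc.comp (NNReal.continuous_coe.prodMk hx)
  have hRSVlim : Tendsto RSV atTop
      (𝓝 (∫ s in (0 : ℝ)..(t : ℝ), g (s.toNNReal : ℝ) (x s.toNNReal) * b s)) := by
    refine tendsto_of_forall_mesh (c := ∫ s in (0 : ℝ)..(t : ℝ), |b s|)
      (intervalIntegral.integral_nonneg (NNReal.coe_nonneg t) fun s _ ↦ abs_nonneg _)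
      hvmono hδ hmesh fun ε hε ↦ ?_
    obtain ⟨δ₀, hδ₀, hb'⟩ := exists_forall_abs_sum_mul_incr_primitive_sub_le hφc t hb hε
    refine ⟨δ₀, hδ₀, fun j hj ↦ ?_⟩
    have := hb' (N j) (v j) (hvt j) hj
    simp only [hv0, hvN, NNReal.coe_zero, ← hV] at this
    exact this
  -- (c) quadratic sums: `QSx - QSJ → 0`, `∑ (ΔV)² → 0`
  obtain ⟨M, hM⟩ := exists_forall_abs_le_of_continuous hx t
  obtain ⟨Ch, hCh⟩ : ∃ Ch : ℝ, ∀ s ∈ Set.Icc (0 : ℝ) t, ∀ y ∈ Set.Icc (-M) M, |h s y| ≤ Ch := by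
    obtain ⟨Ch, hCh⟩ := (isCompact_Icc.prod isCompact_Icc).exists_bound_of_continuousOn
      (s := Set.Icc (0 : ℝ) t ×ˢ Set.Icc (-M) M) hhc.continuousOn
    exact ⟨Ch, fun s hs y hy ↦ by simpa using hCh (s, y) ⟨hs, hy⟩⟩
  have hw : ∀ j i, i ≤ N j → |h (v j i) (x (v j i))| ≤ max Ch 0 := by
    intro j i hi
    exact (hCh _ ⟨NNReal.coe_nonneg _, NNReal.coe_le_coe.2 (hvt j i hi)⟩ _
      (abs_le.1 (hM _ (hvt j i hi)))).trans (le_max_left _ _)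
  have hQSdiff : Tendsto (fun j ↦ QSx j - QSJ j) atTop (𝓝 0) := by
    rw [Metric.tendsto_atTop]
    intro ε hε
    obtain ⟨δ₀, hδ₀, hb'⟩ := exists_forall_abs_quadSum_sub_quadSum_le hb hV hdec hJ (max Ch 0)
      (half_pos hε)
    obtain ⟨j₀, hj₀⟩ := Metric.tendsto_atTop.1 hδ δ₀ hδ₀
    refine ⟨j₀, fun j hjj ↦ ?_⟩
    have hδj : δ j ≤ δ₀ := by
      have := hj₀ j hjj
      rw [Real.dist_eq, sub_zero] at this
      exact (le_abs_self _).trans this.le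
    -- weights clipped outside the grid range do not matter: use the bounded weights on `i ≤ N j`
    have := (hb' (N j) (v j) (fun i ↦ if i ≤ N j then h (v j i) (x (v j i)) else 0)
      (fun i ↦ by
        split_ifs with hi
        · exact hw j i hi
        · simp) (hvt j)
      (fun i hi ↦ ⟨hvmono j i hi, (hmesh j i hi).trans hδj⟩)).1
    rw [Real.dist_eq, sub_zero]
    have heq1 : ∑ i ∈ range (N j), (if i ≤ N j then h (v j i) (x (v j i)) else 0) *
        (x (v j (i + 1)) - x (v j i)) ^ 2 = QSx j :=
      sum_congr rfl fun i hi ↦ by rw [if_pos (mem_range.1 hi).le]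
    have heq2 : ∑ i ∈ range (N j), (if i ≤ N j then h (v j i) (x (v j i)) else 0) *
        (J (v j (i + 1)) - J (v j i)) ^ 2 = QSJ j :=
      sum_congr rfl fun i hi ↦ by rw [if_pos (mem_range.1 hi).le]
    rw [heq1, heq2] at this
    linarith
  have hVsq : Tendsto (fun j ↦ ∑ i ∈ range (N j), (V (v j (i + 1)) - V (v j i)) ^ 2) atTop (𝓝 0) := by
    rw [Metric.tendsto_atTop]
    intro ε hε
    obtain ⟨δ₀, hδ₀, hb'⟩ := exists_forall_abs_quadSum_sub_quadSum_le hb hV hdec hJ 0 (half_pos hε)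
    obtain ⟨j₀, hj₀⟩ := Metric.tendsto_atTop.1 hδ δ₀ hδ₀
    refine ⟨j₀, fun j hjj ↦ ?_⟩
    have hδj : δ j ≤ δ₀ := by
      have := hj₀ j hjj
      rw [Real.dist_eq, sub_zero] at this
      exact (le_abs_self _).trans this.le
    have := (hb' (N j) (v j) (fun _ ↦ 0) (fun _ ↦ by simp) (hvt j)
      (fun i hi ↦ ⟨hvmono j i hi, (hmesh j i hi).trans hδj⟩)).2
    rw [Real.dist_eq, sub_zero, abs_of_nonneg (sum_nonneg fun i _ ↦ sq_nonneg _)]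
    linarith
  -- (d) `QSJ → ∫ h q` by the two-scale limit lemma
  have hhpath : Continuous fun u : ℝ≥0 ↦ h u (x u) := hhc.comp (NNReal.continuous_coe.prodMk hx)
  have hQSJlim : Tendsto QSJ atTop
      (𝓝 (∫ s in (0 : ℝ)..(t : ℝ), h (s.toNNReal : ℝ) (x s.toNNReal) * q s)) :=
    tendsto_weightedQuadSum_of_tendsto_coarse (h := fun u : ℝ≥0 ↦ h u (x u)) hhpath hq hvt hvmono hQS
  have hQSxlim : Tendsto QSx atTop
      (𝓝 (∫ s in (0 : ℝ)..(t : ℝ), h (s.toNNReal : ℝ) (x s.toNNReal) * q s)) := by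
    have := hQSdiff.add hQSJlim
    simp only [zero_add, sub_add_cancel] at this
    exact this
  -- (e) the Taylor remainder
  have hQS1 : Tendsto (fun j ↦ ∑ i ∈ range (N j), (J (v j (i + 1)) - J (v j i)) ^ 2) atTop
      (𝓝 (∫ s in (0 : ℝ)..(t : ℝ), q s)) := by
    have h1 := hQS 0 1 (le_refl _)
    simp only [pow_zero, Nat.cast_one, mul_one, div_one] at h1
    exact h1.congr fun j ↦ sum_indicator_Iio_mul_sq_eq (hvt j) (hvmono j)
  have hRemlim : Tendsto Rem atTop (𝓝 0) := by
    set Qt : ℝ := ∫ s in (0 : ℝ)..(t : ℝ), q s with hQt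
    rw [Metric.tendsto_atTop]
    intro ε hε
    -- accuracy `ε₁` with `ε₁ (2 + 2 (|Qt| + 1)) < ε`
    obtain ⟨ε₁, hε₁, hε₁ε⟩ : ∃ ε₁ : ℝ, 0 < ε₁ ∧ ε₁ * (2 + 2 * (|Qt| + 1)) < ε :=
      ⟨ε / (2 + 2 * (|Qt| + 1) + 1), by positivity, by
        rw [div_mul_eq_mul_div, div_lt_iff₀ (by positivity)]; nlinarith [abs_nonneg Qt]⟩
    obtain ⟨δ₀, hδ₀, hb'⟩ := exists_forall_abs_sum_taylor_le hg hh hhc hx t hε₁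
    obtain ⟨j₀, hj₀⟩ := Metric.tendsto_atTop.1 hδ δ₀ hδ₀
    obtain ⟨j₁, hj₁⟩ := Metric.tendsto_atTop.1 hVsq 1 one_pos
    obtain ⟨j₂, hj₂⟩ := Metric.tendsto_atTop.1 hQS1 1 one_pos
    refine ⟨max j₀ (max j₁ j₂), fun j hjj ↦ ?_⟩
    have hδj : δ j ≤ δ₀ := by
      have := hj₀ j ((le_max_left _ _).trans hjj)
      rw [Real.dist_eq, sub_zero] at this
      exact (le_abs_self _).trans this.le
    have hV1 : ∑ i ∈ range (N j), (V (v j (i + 1)) - V (v j i)) ^ 2 ≤ 1 := by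
      have := hj₁ j ((le_max_left _ _).trans ((le_max_right _ _).trans hjj))
      rw [Real.dist_eq, sub_zero] at this
      exact (le_abs_self _).trans this.le
    have hJ1 : ∑ i ∈ range (N j), (J (v j (i + 1)) - J (v j i)) ^ 2 ≤ |Qt| + 1 := by
      have := hj₂ j ((le_max_right _ _).trans ((le_max_right _ _).trans hjj))
      rw [Real.dist_eq] at this
      have := abs_sub_lt_iff.1 this
      linarith [le_abs_self Qt]
    have hbound := hb' (N j) (v j) (hvt j) (fun i hi ↦ ⟨hvmono j i hi, (hmesh j i hi).trans hδj⟩)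
    -- `∑ (Δx)² ≤ 2 ∑ (ΔV)² + 2 ∑ (ΔJ)²`
    have hxsq : ∑ i ∈ range (N j), (x (v j (i + 1)) - x (v j i)) ^ 2 ≤
        2 * ∑ i ∈ range (N j), (V (v j (i + 1)) - V (v j i)) ^ 2 +
          2 * ∑ i ∈ range (N j), (J (v j (i + 1)) - J (v j i)) ^ 2 := by
      rw [mul_sum, mul_sum, ← sum_add_distrib]
      refine sum_le_sum fun i hi ↦ ?_
      have hiN := mem_range.1 hi
      rw [hdec _ (hvt j (i + 1) hiN), hdec _ (hvt j i hiN.le)]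
      nlinarith [sq_nonneg ((V (v j (i + 1)) - V (v j i)) - (J (v j (i + 1)) - J (v j i)))]
    rw [Real.dist_eq, sub_zero]
    calc |Rem j| ≤ ε₁ * ∑ i ∈ range (N j), (x (v j (i + 1)) - x (v j i)) ^ 2 := hbound
      _ ≤ ε₁ * (2 * 1 + 2 * (|Qt| + 1)) := by
          refine mul_le_mul_of_nonneg_left (hxsq.trans ?_) hε₁.le
          gcongr
      _ < ε := by linarith
  -- Step 3: conclude
  have hconst : Tendsto (fun j ↦ T1 j + (RSV j + RSJ j) + 2⁻¹ * QSx j + Rem j) atTop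
      (𝓝 ((∫ s in (0 : ℝ)..(t : ℝ), k s (x s.toNNReal)) +
        ((∫ s in (0 : ℝ)..(t : ℝ), g (s.toNNReal : ℝ) (x s.toNNReal) * b s) + κ) +
        2⁻¹ * (∫ s in (0 : ℝ)..(t : ℝ), h (s.toNNReal : ℝ) (x s.toNNReal) * q s) + 0)) :=
    ((hT1lim.add (hRSVlim.add hRS)).add (hQSxlim.const_mul _)).add hRemlim
  have hlim := tendsto_nhds_unique (tendsto_const_nhds.congr fun j ↦ hdecomp j) hconst
  rw [add_zero] at hlim
  -- assemble the integrals
  have hIk : IntervalIntegrable (fun s ↦ k s (x s.toNNReal)) volume (0 : ℝ) t :=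
    (hkc.comp (continuous_id.prodMk hx')).intervalIntegrable _ _
  have hbI : IntervalIntegrable b volume (0 : ℝ) t :=
    (hb.mono_set (by rw [Set.uIcc_of_le (NNReal.coe_nonneg t)])).intervalIntegrable
  have hqI : IntervalIntegrable q volume (0 : ℝ) t :=
    (hq.mono_set (by rw [Set.uIcc_of_le (NNReal.coe_nonneg t)])).intervalIntegrable
  have hgx : Continuous fun s : ℝ ↦ g (s.toNNReal : ℝ) (x s.toNNReal) :=
    hgc.comp ((continuous_real_toNNReal.subtype_val).prodMk hx')
  have hhx : Continuous fun s : ℝ ↦ h (s.toNNReal : ℝ) (x s.toNNReal) :=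
    hhc.comp ((continuous_real_toNNReal.subtype_val).prodMk hx')
  have hIg : IntervalIntegrable (fun s ↦ g (s.toNNReal : ℝ) (x s.toNNReal) * b s) volume (0 : ℝ) t :=
    hbI.continuousOn_mul hgx.continuousOn
  have hIh : IntervalIntegrable (fun s ↦ h (s.toNNReal : ℝ) (x s.toNNReal) * q s) volume (0 : ℝ) t :=
    hqI.continuousOn_mul hhx.continuousOn
  have hsum : (∫ s in (0 : ℝ)..(t : ℝ), (k s (x s.toNNReal) + b s * g (s.toNNReal : ℝ) (x s.toNNReal) +
      2⁻¹ * q s * h (s.toNNReal : ℝ) (x s.toNNReal))) =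
      (∫ s in (0 : ℝ)..(t : ℝ), k s (x s.toNNReal)) +
        (∫ s in (0 : ℝ)..(t : ℝ), g (s.toNNReal : ℝ) (x s.toNNReal) * b s) +
        2⁻¹ * ∫ s in (0 : ℝ)..(t : ℝ), h (s.toNNReal : ℝ) (x s.toNNReal) * q s := by
    rw [← intervalIntegral.integral_const_mul, ← integral_add hIk hIg,
      ← integral_add (hIk.add hIg) (hIh.const_mul _)]
    refine intervalIntegral.integral_congr fun s _ ↦ ?_
    ring
  rw [hsum]
  linarith

end Limits

end Literature.Probability.Process
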